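import Literature.Topology.FourManifolds.TrisectionsHeegaardData
import Literature.Topology.FourManifolds.MorseBirthInsertion
import HarnessLib

/-!
# Stabilising the Heegaard function of the level: raising the genus by one at a time

Topic `Literature/Topology/FourManifolds`; a step towards the balancing in Gay–Kirby's proof of
Thm. 4 (*"Stabilize the Heegaard splitting exactly `k₂` times"*, §4, p. 14 of arXiv:1205.1565)
for the fact seat `provefact-Literature.Topology.FourManifolds.exists_isBalancedGKTrisection`.
Everything in this file is **proved**; no definitions, no named facts.

* `exists_criticalValue_gap` — the critical values of a Morse function on a compact manifold keep
  a positive distance from a regular value.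
* `exists_stabilize_step` — **one stabilisation of an ordered Morse function** `φ` with regular
  value `b` (index `≤ 1` below, `≥ 2` above) on a closed connected `3`-manifold: Milnor's
  insertion of a cancelling pair of critical points of indices `1, 2` (Milnor 1965, Lemma 8.2 and
  proof of Thm. 8.1, the tree's `IsMorse.exists_insert_birthPair`) near a point of the level,
  followed by the choice of the new splitting level `b'` between the two new critical values,
  gives an ordered Morse function `φ'`, `δ`-close to `φ`, equal to `φ` on any prescribed set on
  which `φ ≤ b₀ < b`, with the same number of critical points of index `0` below the level and
  one more of index `1` — the Heegaard genus goes up by one (a stabilisation of the Heegaard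
  splitting `{φ ≤ b} ∪ {b ≤ φ}`).
* `exists_stabilize` — `s` stabilisations.
* `exists_handles_of_ordered` — the handlebody package of an ordered Morse function (both sides
  connected handlebodies with one `0`-handle and the same number `gen` of `1`-handles,
  `gen + c₀(φ, <b) = c₁(φ, <b) + 1`, connected Heegaard surface), as in
  `TrisectionsHeegaardData.lean`.

## References

* D. Gay, R. Kirby, *Trisecting 4-manifolds*, Geom. Topol. 20 (2016), §4 (proof of Thm. 4). [GayKirby2016]
* J. Milnor, *Lectures on the h-cobordism theorem* (1965), Lemma 8.2, Thms. 8.1, 2.7. [MilnorHCobordism1965]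
* J. Milnor, *Morse theory* (1963), §3. [Milnor1963]
-/

open scoped Manifold ContDiff Topology
open Set Function Filter Metric

noncomputable section

universe u

namespace Literature.Topology.FourManifolds

variable {Y : Type u} [TopologicalSpace Y] [T2Space Y] [CompactSpace Y]
  [ChartedSpace (EuclideanSpace ℝ (Fin 3)) Y] [IsManifold (𝓡 3) ∞ Y]

omit [T2Space Y] in
/-- **The critical values keep a positive distance from a regular value.** [folklore] -/
theorem exists_criticalValue_gap {φ : Y → ℝ} (hφ : IsMorse (𝓡 3) φ) {b : ℝ} (hb : IsRegularLevel (𝓡 3) φ b) :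
    ∃ γ : ℝ, 0 < γ ∧ ∀ y, IsMCriticalPt (𝓡 3) φ y → γ ≤ |φ y - b| := by
  set S : Set Y := criticalSet (𝓡 3) φ with hS
  have hfin : S.Finite := IsMorse.finite_criticalSet_holds hφ
  by_cases hne : S.Nonempty
  · obtain ⟨y₀, hy₀, hmin⟩ := S.exists_min_image (fun y => |φ y - b|) hfin hne
    refine ⟨|φ y₀ - b|, abs_pos.2 (sub_ne_zero.2 fun h => hb.not_isMCriticalPt h hy₀), fun y hy => hmin y hy⟩
  · exact ⟨1, one_pos, fun y hy => (hne ⟨y, hy⟩).elim⟩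

/-- **One stabilisation of an ordered Morse function on a closed connected `3`-manifold.**
[cite: GayKirby2016, §4, proof of Thm. 4] [cite: MilnorHCobordism1965, Lemma 8.2 and proof of Thm. 8.1] -/
theorem exists_stabilize_step [ConnectedSpace Y] {φ : Y → ℝ} (hφM : IsMorse (𝓡 3) φ) {b : ℝ}
    (hb : IsRegularLevel (𝓡 3) φ b)
    (hbelow : ∀ z, IsMCriticalPt (𝓡 3) φ z → φ z < b → morseIndex (𝓡 3) φ z ≤ 1)
    (habove : ∀ z, IsMCriticalPt (𝓡 3) φ z → b < φ z → 2 ≤ morseIndex (𝓡 3) φ z)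
    (hne : ∃ z, φ z = b) {P : Set Y} {b₀ : ℝ} (hP : ∀ y ∈ P, φ y ≤ b₀) (hb₀ : b₀ < b) {δ : ℝ} (hδ : 0 < δ) :
    ∃ (φ' : Y → ℝ) (b' : ℝ), IsMorse (𝓡 3) φ' ∧ IsRegularLevel (𝓡 3) φ' b' ∧ |b' - b| < δ ∧
      (∀ y, |φ' y - φ y| < δ) ∧ (∀ y ∈ P, φ' y = φ y) ∧
      (∀ z, IsMCriticalPt (𝓡 3) φ' z → φ' z < b' → morseIndex (𝓡 3) φ' z ≤ 1) ∧
      (∀ z, IsMCriticalPt (𝓡 3) φ' z → b' < φ' z → 2 ≤ morseIndex (𝓡 3) φ' z) ∧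
      (∃ z, φ' z = b') ∧
      (criticalSetOfIndex (𝓡 3) φ' 0 ∩ φ' ⁻¹' Iio b') = (criticalSetOfIndex (𝓡 3) φ 0 ∩ φ ⁻¹' Iio b) ∧
      (criticalSetOfIndex (𝓡 3) φ' 1 ∩ φ' ⁻¹' Iio b').ncard = (criticalSetOfIndex (𝓡 3) φ 1 ∩ φ ⁻¹' Iio b).ncard + 1 := by
  obtain ⟨z, hz⟩ := hne
  obtain ⟨γ, hγ, hgap⟩ := exists_criticalValue_gap hφM hb
  have hφc : Continuous φ := hφM.contMDiff.continuous
  -- the neighbourhood of the insertion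
  set δ₁ : ℝ := min (γ / 4) (min (δ / 4) ((b - b₀) / 2)) with hδ₁
  have hδ₁pos : 0 < δ₁ := lt_min (by linarith) (lt_min (by linarith) (by linarith))
  have hδ₁γ : δ₁ ≤ γ / 4 := min_le_left _ _
  have hδ₁δ : δ₁ ≤ δ / 4 := (min_le_right _ _).trans (min_le_left _ _)
  have hδ₁b : δ₁ ≤ (b - b₀) / 2 := (min_le_right _ _).trans (min_le_right _ _)
  set U : Set Y := {y | |φ y - b| < δ₁} with hU
  have hUo : IsOpen U := isOpen_lt (continuous_abs.comp (hφc.sub continuous_const)) continuous_const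
  have hzU : z ∈ U := by show |φ z - b| < δ₁; rw [hz, sub_self, abs_zero]; exact hδ₁pos
  have hUP : ∀ y ∈ U, y ∉ P := by
    intro y hyU hyP
    have h1 : |φ y - b| < δ₁ := hyU
    have h2 := hP y hyP
    rw [abs_lt] at h1
    linarith [h1.1]
  -- Milnor's insertion of a cancelling `1`–`2` pair
  obtain ⟨g, hgM, ⟨K, -, hKU, -, hgf⟩, hε, hev, hidx, q, r, hqU, hrU, hqr, hq, hr, hcrit, hiq, hir, hlt⟩ :=
    hφM.exists_insert_birthPair (BoundarylessManifold.isInteriorPoint (I := 𝓡 3)) (hb.not_isMCriticalPt hz)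
      (hUo.mem_nhds hzU) (k := 1) (by norm_num) hδ₁pos
  have hgc : Continuous g := hgM.contMDiff.continuous
  -- the new level
  set b' : ℝ := (g q + g r) / 2 with hb'
  have hqb' : g q < b' := by rw [hb']; linarith
  have hb'r : b' < g r := by rw [hb']; linarith
  have hgq : |g q - b| < 2 * δ₁ := by
    have h1 : |φ q - b| < δ₁ := hqU
    have h2 := hε q
    calc |g q - b| = |(g q - φ q) + (φ q - b)| := by ring_nf
      _ ≤ |g q - φ q| + |φ q - b| := abs_add_le _ _
      _ < δ₁ + δ₁ := add_lt_add h2 h1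
      _ = 2 * δ₁ := by ring
  have hgr : |g r - b| < 2 * δ₁ := by
    have h1 : |φ r - b| < δ₁ := hrU
    have h2 := hε r
    calc |g r - b| = |(g r - φ r) + (φ r - b)| := by ring_nf
      _ ≤ |g r - φ r| + |φ r - b| := abs_add_le _ _
      _ < δ₁ + δ₁ := add_lt_add h2 h1
      _ = 2 * δ₁ := by ring
  have hbb' : |b' - b| < 2 * δ₁ := by
    rw [abs_lt] at hgq hgr ⊢
    constructor <;> [rw [hb']; rw [hb']] <;> linarith [hgq.1, hgq.2, hgr.1, hgr.2]
  -- the old critical points: values and indices unchanged, far from `b'`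
  have hold_eq : ∀ y, IsMCriticalPt (𝓡 3) φ y → g y = φ y := fun y hy => (hev y hy).self_of_nhds
  have hold_far : ∀ y, IsMCriticalPt (𝓡 3) φ y → (φ y < b ↔ g y < b') := by
    intro y hy
    have h1 := hgap y hy
    rw [hold_eq y hy]
    have h2 : |b' - b| < γ / 2 := by linarith [hbb']
    rw [abs_lt] at h2
    constructor
    · intro h
      have : φ y - b ≤ -γ := by
        rcases le_or_gt (φ y - b) 0 with h0 | h0
        · rw [abs_of_nonpos h0] at h1; linarith
        · linarith
      linarith [h2.1]
    · intro h
      by_contra hge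
      push Not at hge
      have : γ ≤ φ y - b := by
        have hne' : φ y ≠ b := fun heq => hb.not_isMCriticalPt heq hy
        have hpos : 0 < φ y - b := lt_of_le_of_ne (by linarith) (Ne.symm (sub_ne_zero.2 hne'))
        rw [abs_of_pos hpos] at h1; exact h1
      linarith [h2.2]
  have hold_far' : ∀ y, IsMCriticalPt (𝓡 3) φ y → (b < φ y ↔ b' < g y) := by
    intro y hy
    have h1 := hgap y hy
    have hne' : φ y ≠ b := fun heq => hb.not_isMCriticalPt heq hy
    have h := hold_far y hy
    rw [hold_eq y hy] at h ⊢
    have h2 : |b' - b| < γ / 2 := by linarith [hbb']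
    rw [abs_lt] at h2
    constructor
    · intro hlt'
      have : γ ≤ φ y - b := by rw [abs_of_pos (by linarith)] at h1; exact h1
      linarith [h2.2]
    · intro hlt'
      rcases lt_trichotomy (φ y) b with hl | he | hg
      · exact absurd (h.1 hl) (by linarith)
      · exact absurd he hne'
      · exact hg
  -- membership in the new critical set
  have hcrit_iff : ∀ y, IsMCriticalPt (𝓡 3) g y ↔ y = q ∨ y = r ∨ IsMCriticalPt (𝓡 3) φ y := by
    intro y
    have : y ∈ criticalSet (𝓡 3) g ↔ y ∈ insert q (insert r (criticalSet (𝓡 3) φ)) := by rw [hcrit]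
    simpa only [mem_insert_iff, criticalSet, mem_setOf_eq] using this
  have hqcrit : IsMCriticalPt (𝓡 3) g q := (hcrit_iff q).2 (Or.inl rfl)
  have hrcrit : IsMCriticalPt (𝓡 3) g r := (hcrit_iff r).2 (Or.inr (Or.inl rfl))
  -- regularity of `b'`
  have hb'reg : IsRegularLevel (𝓡 3) g b' := by
    refine ⟨hgM.contMDiff, fun y _ => BoundarylessManifold.isInteriorPoint, fun y hy hc => ?_⟩
    rcases (hcrit_iff y).1 hc with rfl | rfl | hold
    · exact absurd hy hqb'.ne
    · exact absurd hy hb'r.ne'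
    · rcases lt_trichotomy (φ y) b with hl | he | hg
      · exact absurd hy ((hold_far y hold).1 hl).ne
      · exact hb.not_isMCriticalPt he hold
      · exact absurd hy ((hold_far' y hold).1 hg).ne'
  -- the ordering
  have hbelow' : ∀ y, IsMCriticalPt (𝓡 3) g y → g y < b' → morseIndex (𝓡 3) g y ≤ 1 := by
    intro y hy hyb
    rcases (hcrit_iff y).1 hy with rfl | rfl | hold
    · rw [hiq]
    · exact absurd hyb (not_lt.2 hb'r.le)
    · rw [hidx y hold]; exact hbelow y hold ((hold_far y hold).2 hyb)
  have habove' : ∀ y, IsMCriticalPt (𝓡 3) g y → b' < g y → 2 ≤ morseIndex (𝓡 3) g y := by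
    intro y hy hyb
    rcases (hcrit_iff y).1 hy with rfl | rfl | hold
    · exact absurd hyb (not_lt.2 hqb'.le)
    · rw [hir]
    · rw [hidx y hold]; exact habove y hold ((hold_far' y hold).2 hyb)
  -- the counts
  have hset0 : criticalSetOfIndex (𝓡 3) g 0 ∩ g ⁻¹' Iio b' = criticalSetOfIndex (𝓡 3) φ 0 ∩ φ ⁻¹' Iio b := by
    ext y
    simp only [mem_inter_iff, mem_criticalSetOfIndex, mem_preimage, mem_Iio]
    constructor
    · rintro ⟨⟨hy, hi⟩, hyb⟩
      rcases (hcrit_iff y).1 hy with rfl | rfl | hold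
      · rw [hiq] at hi; exact absurd hi one_ne_zero
      · rw [hir] at hi; exact absurd hi (by norm_num)
      · exact ⟨⟨hold, by rw [← hidx y hold]; exact hi⟩, (hold_far y hold).2 hyb⟩
    · rintro ⟨⟨hy, hi⟩, hyb⟩
      exact ⟨⟨(hcrit_iff y).2 (Or.inr (Or.inr hy)), by rw [hidx y hy]; exact hi⟩, (hold_far y hy).1 hyb⟩
  have hset1 : criticalSetOfIndex (𝓡 3) g 1 ∩ g ⁻¹' Iio b' = insert q (criticalSetOfIndex (𝓡 3) φ 1 ∩ φ ⁻¹' Iio b) := by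
    ext y
    simp only [mem_inter_iff, mem_criticalSetOfIndex, mem_preimage, mem_Iio, mem_insert_iff]
    constructor
    · rintro ⟨⟨hy, hi⟩, hyb⟩
      rcases (hcrit_iff y).1 hy with rfl | rfl | hold
      · exact Or.inl rfl
      · rw [hir] at hi; exact absurd hi (by norm_num)
      · exact Or.inr ⟨⟨hold, by rw [← hidx y hold]; exact hi⟩, (hold_far y hold).2 hyb⟩
    · rintro (rfl | ⟨⟨hy, hi⟩, hyb⟩)
      · exact ⟨⟨hqcrit, hiq⟩, hqb'⟩
      · exact ⟨⟨(hcrit_iff y).2 (Or.inr (Or.inr hy)), by rw [hidx y hy]; exact hi⟩, (hold_far y hy).1 hyb⟩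
  have hfin1 : (criticalSetOfIndex (𝓡 3) φ 1 ∩ φ ⁻¹' Iio b).Finite :=
    (IsMorse.finite_criticalSet_holds hφM).subset fun y hy => hy.1.1
  have hq1 : q ∉ criticalSetOfIndex (𝓡 3) φ 1 ∩ φ ⁻¹' Iio b := fun h => hq h.1.1
  refine ⟨g, b', hgM, hb'reg, ?_, fun y => (hε y).trans_le (by linarith), fun y hy => hgf y fun hyK => hUP y (hKU hyK) hy,
    hbelow', habove', ?_, hset0, by rw [hset1, ncard_insert_of_notMem hq1 hfin1]⟩
  · linarith [hbb']
  · obtain ⟨y, hy⟩ := intermediate_value_univ q r hgc ⟨hqb'.le, hb'r.le⟩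
    exact ⟨y, hy⟩

/-- **`s` stabilisations of an ordered Morse function on a closed connected `3`-manifold.**
[cite: GayKirby2016, §4, proof of Thm. 4] [cite: MilnorHCobordism1965, Lemma 8.2 and proof of Thm. 8.1] -/
theorem exists_stabilize [ConnectedSpace Y] {φ : Y → ℝ} (hφM : IsMorse (𝓡 3) φ) {b : ℝ}
    (hb : IsRegularLevel (𝓡 3) φ b)
    (hbelow : ∀ z, IsMCriticalPt (𝓡 3) φ z → φ z < b → morseIndex (𝓡 3) φ z ≤ 1)
    (habove : ∀ z, IsMCriticalPt (𝓡 3) φ z → b < φ z → 2 ≤ morseIndex (𝓡 3) φ z)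
    (hne : ∃ z, φ z = b) {P : Set Y} {b₀ : ℝ} (hP : ∀ y ∈ P, φ y ≤ b₀) {δ : ℝ} (hδ : 0 < δ)
    (hδb : δ ≤ b - b₀) (s : ℕ) :
    ∃ (φ' : Y → ℝ) (b' : ℝ), IsMorse (𝓡 3) φ' ∧ IsRegularLevel (𝓡 3) φ' b' ∧ |b' - b| < δ ∧
      (∀ y, |φ' y - φ y| < δ) ∧ (∀ y ∈ P, φ' y = φ y) ∧
      (∀ z, IsMCriticalPt (𝓡 3) φ' z → φ' z < b' → morseIndex (𝓡 3) φ' z ≤ 1) ∧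
      (∀ z, IsMCriticalPt (𝓡 3) φ' z → b' < φ' z → 2 ≤ morseIndex (𝓡 3) φ' z) ∧
      (∃ z, φ' z = b') ∧
      (criticalSetOfIndex (𝓡 3) φ' 0 ∩ φ' ⁻¹' Iio b') = (criticalSetOfIndex (𝓡 3) φ 0 ∩ φ ⁻¹' Iio b) ∧
      (criticalSetOfIndex (𝓡 3) φ' 1 ∩ φ' ⁻¹' Iio b').ncard = (criticalSetOfIndex (𝓡 3) φ 1 ∩ φ ⁻¹' Iio b).ncard + s := by
  -- induction with the step size `δ / (2 * (s + 1))`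
  have hmain : ∀ t : ℕ, t ≤ s → ∃ (φ' : Y → ℝ) (b' : ℝ), IsMorse (𝓡 3) φ' ∧ IsRegularLevel (𝓡 3) φ' b' ∧
      |b' - b| ≤ t * (δ / (2 * (s + 1))) ∧ (∀ y, |φ' y - φ y| ≤ t * (δ / (2 * (s + 1)))) ∧ (∀ y ∈ P, φ' y = φ y) ∧
      (∀ z, IsMCriticalPt (𝓡 3) φ' z → φ' z < b' → morseIndex (𝓡 3) φ' z ≤ 1) ∧
      (∀ z, IsMCriticalPt (𝓡 3) φ' z → b' < φ' z → 2 ≤ morseIndex (𝓡 3) φ' z) ∧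
      (∃ z, φ' z = b') ∧
      (criticalSetOfIndex (𝓡 3) φ' 0 ∩ φ' ⁻¹' Iio b') = (criticalSetOfIndex (𝓡 3) φ 0 ∩ φ ⁻¹' Iio b) ∧
      (criticalSetOfIndex (𝓡 3) φ' 1 ∩ φ' ⁻¹' Iio b').ncard = (criticalSetOfIndex (𝓡 3) φ 1 ∩ φ ⁻¹' Iio b).ncard + t := by
    have hstep : 0 < δ / (2 * (s + 1)) := by positivity
    intro t
    induction t with
    | zero =>
      intro _
      exact ⟨φ, b, hφM, hb, by simp, fun y => by simp, fun y _ => rfl, hbelow, habove, hne, rfl, by simp⟩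
    | succ t ih =>
      intro ht
      obtain ⟨φ₁, b₁, hφ₁, hb₁, hbb, hφφ, hP₁, hbelow₁, habove₁, hne₁, hset₁, hcount₁⟩ := ih (Nat.le_of_succ_le ht)
      -- `P` still lies below `b₀ + t δ/(s+1) < b₁`
      have htle : (t : ℝ) * (δ / (2 * (s + 1))) ≤ s * (δ / (2 * (s + 1))) := by
        have : (t : ℝ) ≤ s := by exact_mod_cast (Nat.le_of_succ_le ht)
        exact mul_le_mul_of_nonneg_right this hstep.le
      have hsδ : 2 * ((s : ℝ) * (δ / (2 * (s + 1)))) < δ := by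
        have : 2 * ((s : ℝ) * (δ / (2 * (s + 1)))) = δ * (s / (s + 1)) := by field_simp
        rw [this]
        have hlt1 : (s : ℝ) / (s + 1) < 1 := (div_lt_one (by positivity)).2 (by linarith)
        nlinarith
      have hP' : ∀ y ∈ P, φ₁ y ≤ b₀ + t * (δ / (2 * (s + 1))) := fun y hy => by
        rw [hP₁ y hy]
        have h2 := hP y hy
        have h3 : (0 : ℝ) ≤ t * (δ / (2 * (s + 1))) := by positivity
        linarith
      have hb₀' : b₀ + t * (δ / (2 * (s + 1))) < b₁ := by
        rw [abs_le] at hbb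
        linarith [hbb.1]
      obtain ⟨φ₂, b₂, hφ₂, hb₂, hbb₂, hφφ₂, hP₂, hbelow₂, habove₂, hne₂, hset₂, hcount₂⟩ :=
        exists_stabilize_step hφ₁ hb₁ hbelow₁ habove₁ hne₁ hP' hb₀' hstep
      refine ⟨φ₂, b₂, hφ₂, hb₂, ?_, fun y => ?_, fun y hy => (hP₂ y hy).trans (hP₁ y hy), hbelow₂, habove₂, hne₂,
        hset₂.trans hset₁, by rw [hcount₂, hcount₁]; ring⟩
      · have : |b₂ - b| ≤ |b₂ - b₁| + |b₁ - b| := by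
          calc |b₂ - b| = |(b₂ - b₁) + (b₁ - b)| := by ring_nf
            _ ≤ |b₂ - b₁| + |b₁ - b| := abs_add_le _ _
        push_cast; linarith [hbb₂.le]
      · have : |φ₂ y - φ y| ≤ |φ₂ y - φ₁ y| + |φ₁ y - φ y| := by
          calc |φ₂ y - φ y| = |(φ₂ y - φ₁ y) + (φ₁ y - φ y)| := by ring_nf
            _ ≤ |φ₂ y - φ₁ y| + |φ₁ y - φ y| := abs_add_le _ _
        push_cast; linarith [(hφφ₂ y).le, hφφ y]
  obtain ⟨φ', b', h1, h2, h3, h4, h5, h6, h7, h8, h9, h10⟩ := hmain s le_rfl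
  have hsδ : (s : ℝ) * (δ / (2 * (s + 1))) < δ := by
    have : (s : ℝ) * (δ / (2 * (s + 1))) = δ * (s / (2 * (s + 1))) := by field_simp
    rw [this]
    have hlt1 : (s : ℝ) / (2 * (s + 1)) < 1 := (div_lt_one (by positivity)).2 (by linarith)
    nlinarith
  exact ⟨φ', b', h1, h2, h3.trans_lt hsδ, fun y => (h4 y).trans_lt hsδ, h5, h6, h7, h8, h9, h10⟩

/-- **The handlebody package of an ordered Morse function** on a closed connected `3`-manifold:
both sides of the regular level `b` are connected handlebodies with one `0`-handle and the same
number `gen` of `1`-handles, `gen + c₀(φ, <b) = c₁(φ, <b) + 1`, and the level is connected.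
[cite: MilnorHCobordism1965, Thms. 2.7, 4.8, 8.1] [cite: Milnor1963, §3] -/
theorem exists_handles_of_ordered [SecondCountableTopology Y] [ConnectedSpace Y] {φ : Y → ℝ} (hφM : IsMorse (𝓡 3) φ) {b : ℝ}
    (hb : IsRegularLevel (𝓡 3) φ b)
    (hbelow : ∀ z, IsMCriticalPt (𝓡 3) φ z → φ z < b → morseIndex (𝓡 3) φ z ≤ 1)
    (habove : ∀ z, IsMCriticalPt (𝓡 3) φ z → b < φ z → 2 ≤ morseIndex (𝓡 3) φ z) :
    ∃ gen : ℕ, HasHandleDecomposition 2 (RegularSublevel hb) (handleCount 1 gen) ∧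
      HasHandleDecomposition 2 (RegularSuperlevel hb) (handleCount 1 gen) ∧
      gen + (criticalSetOfIndex (𝓡 3) φ 0 ∩ φ ⁻¹' Iio b).ncard = (criticalSetOfIndex (𝓡 3) φ 1 ∩ φ ⁻¹' Iio b).ncard + 1 ∧
      IsConnected (φ ⁻¹' {b}) ∧ ConnectedSpace (RegularSublevel hb) ∧ ConnectedSpace (RegularSuperlevel hb) := by
  have hbreg : ∀ z, IsMCriticalPt (𝓡 3) φ z → φ z ≠ b := fun z hz heq => hb.not_isMCriticalPt heq hz
  obtain ⟨zmin, -, hzmin⟩ := isCompact_univ.exists_isMinOn univ_nonempty hφM.contMDiff.continuous.continuousOn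
  obtain ⟨zmax, -, hzmax⟩ := isCompact_univ.exists_isMaxOn univ_nonempty hφM.contMDiff.continuous.continuousOn
  have hminloc : IsLocalMin φ zmin := hzmin.isLocalMin univ_mem
  have hmaxloc : IsLocalMax φ zmax := hzmax.isLocalMax univ_mem
  have hzmin_b : φ zmin < b := by
    have hcz : IsMCriticalPt (𝓡 3) φ zmin := IsLocalMin.isMCriticalPt hminloc
    have h0 := hφM.morseIndex_eq_zero_of_isLocalMin hminloc
    rcases lt_trichotomy (φ zmin) b with hlt | heq | hgt
    · exact hlt
    · exact absurd heq (hbreg zmin hcz)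
    · have := habove zmin hcz hgt; omega
  have hzmax_b : b < φ zmax := by
    have hcz : IsMCriticalPt (𝓡 3) φ zmax := IsLocalMax.isMCriticalPt hmaxloc
    have h3 := hφM.morseIndex_eq_finrank_of_isLocalMax hmaxloc
    rw [finrank_euclideanSpace_fin] at h3
    rcases lt_trichotomy (φ zmax) b with hlt | heq | hgt
    · have := hbelow zmax hcz hlt; omega
    · exact absurd heq (hbreg zmax hcz)
    · exact hgt
  have hconn₁ : ConnectedSpace (RegularSublevel hb) :=
    RegularSublevel.connectedSpace_of_two_le_morseIndex hφM hb
      (fun z hz hbz => habove z hz (lt_of_le_of_ne hbz fun h' => hbreg z hz h'.symm)) ⟨zmin, hzmin_b.le⟩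
  have hconn₂ : ConnectedSpace (RegularSuperlevel hb) :=
    RegularSublevel.connectedSpace_superlevel_of_morseIndex_add_two_le hφM hb
      (fun z hz hzb => by
        have := hbelow z hz (lt_of_le_of_ne hzb (hbreg z hz))
        change morseIndex (𝓡 3) φ z + 2 ≤ 3
        omega) ⟨zmax, hzmax_b.le⟩
  haveI : Nonempty (RegularSublevel hb) := ⟨RegularSublevel.mk hb zmin hzmin_b.le⟩
  haveI : Nonempty (RegularSuperlevel hb) :=
    ⟨RegularSublevel.mk hb.const_sub zmax (by simp only [sub_nonpos]; exact hzmax_b.le)⟩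
  haveI := hconn₁
  haveI := hconn₂
  have hdec₁ : ∃ g₁, g₁ + (criticalSetOfIndex (𝓡 3) φ 0 ∩ φ ⁻¹' Iic b).ncard =
      (criticalSetOfIndex (𝓡 3) φ 1 ∩ φ ⁻¹' Iic b).ncard + 1 ∧
      HasHandleDecomposition 2 (RegularSublevel hb) (handleCount 1 g₁) := by
    refine HasHandleDecomposition.exists_handleCount_one
      (RegularSublevel.hasHandleDecomposition hφM hb) (fun i hi => ?_)
    have hempty : criticalSetOfIndex (𝓡 3) φ i ∩ φ ⁻¹' Iic b = ∅ := by
      refine Set.eq_empty_of_forall_notMem fun z hz => ?_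
      obtain ⟨⟨hzc, hzi⟩, hzb⟩ := hz
      have hzb' : φ z < b := lt_of_le_of_ne hzb (hbreg z hzc)
      have h' : morseIndex (𝓡 3) φ z ≤ 1 := hbelow z hzc hzb'
      omega
    rw [hempty, Set.ncard_empty]
  have hφ' : IsMorse (𝓡 3) (fun y => b - φ y) := hφM.const_sub b
  have hdec₂ : ∃ g₂, g₂ + (criticalSetOfIndex (𝓡 3) (fun y => b - φ y) 0 ∩
        (fun y => b - φ y) ⁻¹' Iic 0).ncard =
      (criticalSetOfIndex (𝓡 3) (fun y => b - φ y) 1 ∩ (fun y => b - φ y) ⁻¹' Iic 0).ncard + 1 ∧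
      HasHandleDecomposition 2 (RegularSuperlevel hb) (handleCount 1 g₂) := by
    refine HasHandleDecomposition.exists_handleCount_one
      (RegularSublevel.hasHandleDecomposition hφ' hb.const_sub) (fun i hi => ?_)
    have hempty : criticalSetOfIndex (𝓡 3) (fun y => b - φ y) i ∩ (fun y => b - φ y) ⁻¹' Iic 0 = ∅ := by
      refine Set.eq_empty_of_forall_notMem fun z hz => ?_
      obtain ⟨⟨hzc, hzi⟩, hzb⟩ := hz
      have hzi' : morseIndex (𝓡 3) (fun y => b - φ y) z = i := hzi
      have hd : MDifferentiableAt (𝓡 3) 𝓘(ℝ, ℝ) φ z := hφM.contMDiff.mdifferentiableAt (by simp)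
      have hzc' : IsMCriticalPt (𝓡 3) φ z := (isMCriticalPt_const_sub_iff b hd).1 hzc
      have hsum := hφM.morseIndex_const_sub_add b hzc'
      rw [finrank_euclideanSpace_fin] at hsum
      have hsum' : morseIndex (𝓡 3) (fun y => b - φ y) z + morseIndex (𝓡 3) φ z = 3 := hsum
      have hzb' : b < φ z := by
        simp only [mem_preimage, mem_Iic, sub_nonpos] at hzb
        exact lt_of_le_of_ne hzb fun h' => hbreg z hzc' h'.symm
      have h' : 2 ≤ morseIndex (𝓡 3) φ z := habove z hzc' hzb'
      omega
    rw [hempty, Set.ncard_empty]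
  obtain ⟨g₁, hg₁, hd₁⟩ := hdec₁
  obtain ⟨g₂, hg₂, hd₂⟩ := hdec₂
  have hpre : (fun y => b - φ y) ⁻¹' Iic (0 : ℝ) = φ ⁻¹' Ici b := by
    ext z; simp only [mem_preimage, mem_Iic, mem_Ici, sub_nonpos]
  have hrank : Module.finrank ℝ (EuclideanSpace ℝ (Fin 3)) = 3 := finrank_euclideanSpace_fin
  have h0 : criticalSetOfIndex (𝓡 3) (fun y => b - φ y) 0 = criticalSetOfIndex (𝓡 3) φ 3 := by
    rw [hφM.criticalSetOfIndex_const_sub b (by rw [hrank]; norm_num), hrank]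
  have h1 : criticalSetOfIndex (𝓡 3) (fun y => b - φ y) 1 = criticalSetOfIndex (𝓡 3) φ 2 := by
    rw [hφM.criticalSetOfIndex_const_sub b (by rw [hrank]; norm_num), hrank]
  rw [hpre, h0, h1] at hg₂
  have hχ := hφM.ncard_inter_sub_eq_of_ordered hbelow habove
  have heq : g₁ = g₂ := by omega
  have hlevel : IsConnected (φ ⁻¹' {b}) :=
    isConnected_level_of_connectedSpace_sublevel (k := 2) hφM hb fun z hz hzb => by
      have := hbelow z hz (lt_of_le_of_ne hzb (hbreg z hz))
      change morseIndex (𝓡 3) φ z + 2 ≤ 3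
      omega
  refine ⟨g₁, hd₁, heq ▸ hd₂, ?_, hlevel, hconn₁, hconn₂⟩
  rw [← criticalSetOfIndex_inter_Iic_eq hb 0, ← criticalSetOfIndex_inter_Iic_eq hb 1]; exact hg₁

end Literature.Topology.FourManifolds

end
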